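import Literature.Analysis.FluidPDE.SolenoidalTruncationDecay
import HarnessLib

/-!
# The solenoidal truncation of a field with critical decay: the sup-norm error is `O(1/R)`

Analysis/FluidPDE support file (all results proved; no definitions, no named facts).  The tree's
divergence-free truncation `solenoidalTruncation V R = χ_R V + Dχ_R(x) F − Dχ_R(F) x`
(`SolenoidalTruncation.lean`; `F = poincareField V = ∫₀¹ t V(t ·) dt` the Poincaré homotopy
field) is controlled in `SolenoidalTruncationDecay.lean` for fields with the integrable decay
`‖y‖³‖V y‖ ≤ C₃`.  A Type-I self-similar profile only has the **critical** decay
`‖y‖ ‖V y‖ ≤ C` (Leray's rate `|U(y)| ≲ C₀/|y|`), for which the truncation error does not tend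
to zero in `L²` but does in **sup norm**, at rate `1/R`:

* `norm_poincareField_le_div_of_mul_norm_le` — `‖F(x)‖ ≤ C/‖x‖` for `x ≠ 0`
  (the integrand `t V(t x)` has norm `≤ C/‖x‖` for every `t ∈ (0, 1]`);
* `norm_solenoidalTruncation_sub_le_div` — with the scale-free cut-off bound
  `‖Dχ_R‖ ≤ C₁/R`: `‖Ψ_R(x) − V(x)‖ ≤ (1 + 4 C₁) C / R` for **all** `x` (zero inside `B(0, R)`,
  and on `‖x‖ ≥ R` both `‖V(x)‖` and `‖F(x)‖` are `≤ C/R`);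
* `exists_norm_solenoidalTruncation_sub_le_div` — the same with the tree's cut-off constant
  chosen once: `∃ κ ≥ 0, ∀ V C R, (∀ y, ‖y‖‖V y‖ ≤ C) → 0 < R → ∀ x, ‖Ψ_R x − V x‖ ≤ κ C / R`.

This is the estimate `‖ψ_L(U) − U‖_∞ = O(C₀/L)` by which a compactly supported solenoidal
truncation of a Type-I profile is a small perturbation in the (subcritical) sup norm
(Galdi 2011, §III.4 for solenoidal truncations in general; the rate is elementary).

## Mathlib / tree search

Tree: `poincareField(_apply)`, `solenoidalTruncation`, `norm_solenoidalTruncation_sub_le`,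
`solenoidalTruncation_sub_eq_zero_of_norm_lt`, `exists_norm_fderiv_cutoff_le`
(`SolenoidalTruncation.lean`, `SolenoidalTruncationDecay.lean`, `WholeSpaceIBP.lean`).
Mathlib: `intervalIntegral.norm_integral_le_of_norm_le_const`.

## References

* G. P. Galdi, *An Introduction to the Mathematical Theory of the Navier–Stokes Equations*,
  2nd ed. 2011, §III.4 (solenoidal truncation / Bogovskiĭ correction). [Galdi2011]
-/

noncomputable section

open MeasureTheory Set Filter Metric Function
open _root_.Topology

namespace Literature.Analysis.FluidPDE

variable {E : Type*} [NormedAddCommGroup E] [InnerProductSpace ℝ E] [FiniteDimensional ℝ E]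
  [MeasurableSpace E] [BorelSpace E]

variable {V : E → E} {C R : ℝ}

omit [FiniteDimensional ℝ E] [MeasurableSpace E] [BorelSpace E] in
/-- **Decay of the Poincaré field at the critical rate.** If `‖y‖ ‖V y‖ ≤ C` for all `y`, then
`‖poincareField V x‖ ≤ C / ‖x‖` for every `x ≠ 0`: for `t ∈ (0, 1]`,
`‖t V(t x)‖ = t ‖V(t x)‖ ≤ t · C/(t‖x‖) = C/‖x‖`, and the interval has length `1`. [folklore] -/
theorem norm_poincareField_le_div_of_mul_norm_le (hC : ∀ y, ‖y‖ * ‖V y‖ ≤ C) {x : E}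
    (hx : x ≠ 0) : ‖poincareField V x‖ ≤ C / ‖x‖ := by
  have hxn : 0 < ‖x‖ := norm_pos_iff.2 hx
  rw [poincareField_apply]
  have key : ∀ t ∈ Set.Ioc (0 : ℝ) 1, ‖t • V (t • x)‖ ≤ C / ‖x‖ := by
    intro t ht
    have ht0 : 0 < t := ht.1
    have h1 := hC (t • x)
    rw [norm_smul, Real.norm_of_nonneg ht0.le] at h1 ⊢
    -- `t ‖x‖ ‖V(tx)‖ ≤ C`, hence `t ‖V(tx)‖ ≤ C / ‖x‖`
    rw [le_div_iff₀ hxn]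
    calc t * ‖V (t • x)‖ * ‖x‖ = t * ‖x‖ * ‖V (t • x)‖ := by ring
      _ ≤ C := h1
  have h := intervalIntegral.norm_integral_le_of_norm_le_const (a := 0) (b := 1)
    (f := fun t : ℝ => t • V (t • x)) (C := C / ‖x‖) (fun t ht => key t (by simpa using ht))
  simpa using h

omit [FiniteDimensional ℝ E] [MeasurableSpace E] [BorelSpace E] in
/-- **Sup-norm truncation error at the critical rate.** With the scale-free cut-off gradient
bound `‖Dχ_R‖ ≤ C₁/R` and the decay `‖y‖ ‖V y‖ ≤ C`, for `0 < R` and every `x`: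
`‖solenoidalTruncation V R x − V x‖ ≤ (1 + 4 C₁) C / R`.  Inside `B(0, R)` the error is `0`;
for `‖x‖ ≥ R`, `norm_solenoidalTruncation_sub_le` bounds it by `‖V x‖ + 4 C₁ ‖F x‖` and both
terms are `≤ C/‖x‖ ≤ C/R`. [folklore] -/
theorem norm_solenoidalTruncation_sub_le_div {C₁ : ℝ} (hC₁ : 0 ≤ C₁)
    (hcut : ∀ R : ℝ, 0 < R → ∀ x : E, ‖fderiv ℝ (cutoff (E := E) R) x‖ ≤ C₁ / R)
    (hC : ∀ y, ‖y‖ * ‖V y‖ ≤ C) (hR : 0 < R) (x : E) :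
    ‖solenoidalTruncation V R x - V x‖ ≤ (1 + 4 * C₁) * C / R := by
  have hC0 : 0 ≤ C := by simpa using hC 0
  rcases lt_or_ge ‖x‖ R with hxR | hxR
  · rw [solenoidalTruncation_sub_eq_zero_of_norm_lt hR hxR, norm_zero]
    positivity
  · have hxn : 0 < ‖x‖ := hR.trans_le hxR
    have hx0 : x ≠ 0 := norm_pos_iff.1 hxn
    have hV : ‖V x‖ ≤ C / R := by
      have h1 := hC x
      rw [le_div_iff₀ hR]
      calc ‖V x‖ * R ≤ ‖V x‖ * ‖x‖ := by gcongr
        _ = ‖x‖ * ‖V x‖ := mul_comm _ _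
        _ ≤ C := h1
    have hF : ‖poincareField V x‖ ≤ C / R :=
      (norm_poincareField_le_div_of_mul_norm_le hC hx0).trans
        (div_le_div_of_nonneg_left hC0 hR hxR)
    calc ‖solenoidalTruncation V R x - V x‖
        ≤ ‖V x‖ + 4 * C₁ * ‖poincareField V x‖ :=
          norm_solenoidalTruncation_sub_le hC₁ hcut hR x
      _ ≤ C / R + 4 * C₁ * (C / R) := by gcongr
      _ = (1 + 4 * C₁) * C / R := by ring

omit [MeasurableSpace E] [BorelSpace E] in
/-- **Sup-norm truncation error at the critical rate, with a universal constant.** There is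
`κ ≥ 0` (depending only on the tree's cut-off profile) such that for every field `V` with
`‖y‖ ‖V y‖ ≤ C` and every `R > 0`: `‖solenoidalTruncation V R x − V x‖ ≤ κ C / R` for all `x`.
For a Type-I profile `‖U(y)‖ ≤ C₀/(‖y‖ + 1)` this is the sup-norm smallness `O(C₀/R)` of the
compactly supported solenoidal truncation `Ψ_R(U)` as a perturbation of `U`. [folklore] -/
theorem exists_norm_solenoidalTruncation_sub_le_div :
    ∃ κ : ℝ, 0 ≤ κ ∧ ∀ (V : E → E) (C R : ℝ), (∀ y, ‖y‖ * ‖V y‖ ≤ C) → 0 < R →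
      ∀ x, ‖solenoidalTruncation V R x - V x‖ ≤ κ * C / R := by
  obtain ⟨C₁, hC₁, hcut⟩ := exists_norm_fderiv_cutoff_le (E := E)
  exact ⟨1 + 4 * C₁, by positivity, fun V C R hC hR x =>
    norm_solenoidalTruncation_sub_le_div hC₁ hcut hC hR x⟩

end Literature.Analysis.FluidPDE

end
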